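import Literature.Computability.Complexity.SuccinctWidthBricks
import Literature.Computability.Complexity.ListFoldChecks
import HarnessLib

/-!
# The clause-table checker of a succinct reduction is polynomial time

Literature / complexity toolkit (serves the derivation of Williams' Thm. 5.1 from Thm. 5.2,
`Williams2014Transfer.lean`). For a succinct reduction `cl` with constant `c`
(`IsSuccinctReduction c L cl`: the `i`-th clause of the formula presented on `x` is computable
from `⟨x, bin i⟩` in polynomial time, clauses have at most `3` literals) the universal-witness
argument needs a polynomial-time CHECKER of assignment tables: on `⟨x, y⟩` it accepts iff
`|y| = 2 ^ m(n)` (`m(n) = (c + 1) n² + c`, `n = |x|`) and every clause `cl x i`,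
`i < 2 ^ succinctWidth c n`, is satisfied by the assignment "variable `v` is true iff `v < |y|`
and `y[v] = 1`" (`tableAssignment y`). Polynomial time is in the input length
`2n + 2 + |y|`, i.e. exponential in `n` — this is what an `NEXP`-verifier may spend.

The checker is assembled from the tree's `FP` bricks, no machine is written:

* the counted loop `Brick.loopStep`/`Brick.loopFn_mem_FP` (`BrickAlgebra.lean`) over the records
  `⟨⟨x, y⟩, ⟨counter, state⟩⟩`, counting down from `2 ^ succinctWidth c n`
  (`powTwoWidthFn`, `SuccinctWidthBricks.lean`); in each round the query `⟨x, bin i⟩` of the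
  current clause index `i = counter - 1` is formed (`clauseQueryFn`, always a genuine query word, so
  that the clause function — specified on query words only — composes in the TYPED form of
  `PolyTimeComputable.comp_holds`: `clauseFn_mem_FP`), the clause code
  `⟨1ᵏ, ⟨ℓ₁, ⟨ℓ₂, ⟨ℓ₃, ε⟩⟩⟩⟩`, `ℓ = ⟨bin v, [b]⟩` (`encodingClause`, `CNF.lean`) is taken apart by the
  record projections `Brick.nthF`, each literal is looked up in the table
  (`binToUnaryFn`, `bitAtFn` of `FPStringBricks.lean`) and the state bit accumulates
  "all clauses so far are satisfied" (`bodyFn`, `okClauseFn`);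
* the length test `|y| = 2 ^ m(n)` (`Brick.lenBinF`, `powTwoPolyFn`, `eqPairFn`);
* **`checkFn c cl ∈ FP`** (`checkFn_mem_FP`) and its value **`checkFn_boolPair`**.

All conditions are one-bit on every input (`Brick.OneBit`, `Brick.oneBit_eqPairFn` of
`ListFoldChecks.lean`), so the branch bricks `iteFn`, `andFn`, `notFn`, `Brick.orFn`
(`BrickAlgebra.lean`, `ListFoldBricks.lean`) have their intended semantics everywhere and the
loop body has constant output length.

## References

* S. Arora, B. Barak, *Computational Complexity: A Modern Approach*, CUP 2009, §1.3 (closure of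
  polynomial time under composition and bounded loops), Def. 2.1.
* R. Williams, *Nonuniform ACC circuit lower bounds*, J. ACM 61 (2014), §5 (proof of Thm. 5.1
  from Thm. 5.2: the verifier checking a succinctly described assignment against all clauses).
-/

namespace Literature.Computability.Complexity

open _root_.Computability Polynomial Brick Plumb

/-! ### Table assignments -/

/-- The assignment read off a table `y`: variable `v` is true iff `v < |y|` and the `v`-th bit of
`y` is `1`. [folklore] -/
def tableAssignment (y : List Bool) (v : ℕ) : Bool :=
  decide (v < y.length) && y.getD v false

/-- The target exponent `m(n) = (c + 1) n² + c` of the table length: an affine function of `n²`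
dominating the index width. [folklore] -/
def tableExp (c n : ℕ) : ℕ := (c + 1) * n ^ 2 + c

/-- `succinctWidth c n ≤ tableExp c n` (`log₂ n ≤ n ≤ n²`). [folklore] -/
theorem succinctWidth_le_tableExp (c n : ℕ) : succinctWidth c n ≤ tableExp c n := by
  unfold succinctWidth tableExp
  have h1 : Nat.log 2 n ≤ n := (Nat.log_le_self 2 n)
  have h2 : n ≤ n ^ 2 := by nlinarith
  have h3 : c * Nat.log 2 n ≤ c * n ^ 2 := Nat.mul_le_mul_left c (h1.trans h2)
  nlinarith

/-- The polynomial `(c + 1) X² + c` of `tableExp c`. [folklore] -/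
noncomputable def tableExpPoly (c : ℕ) : Polynomial ℕ := C (c + 1) * X ^ 2 + C c

/-- `tableExpPoly c` evaluates to `tableExp c`. [folklore] -/
@[simp] theorem eval_tableExpPoly (c n : ℕ) : (tableExpPoly c).eval n = tableExp c n := by
  simp [tableExpPoly, tableExp]

/-! ### The rounds of the loop -/

namespace ClauseCheck

/-- The genuine loop record of round `k + 1`: `⟨⟨x, y⟩, ⟨bin (k + 1), s⟩⟩`. [folklore] -/
def rec (x y : List Bool) (k : ℕ) (s : List Bool) : List Bool :=
  boolPair (boolPair x y) (boolPair (encodeNat (k + 1)) s)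

/-- The query word of the current round: `⟨x, bin (counter - 1)⟩`. [folklore] -/
noncomputable def clauseQueryFn : List Bool → List Bool := fanoutFn (fstF ∘ nthF 0) predCntF

/-- `predCntF` on every input. [folklore] -/
theorem predCntF_eq (z : List Bool) : predCntF z = encodeNat (bitsToNat (nthF 1 z) - 1) := by
  simp [predCntF, fanoutFn_apply]

/-- The query word is always a genuine query word. [folklore] -/
theorem clauseQueryFn_eq (z : List Bool) :
    clauseQueryFn z = encodeClauseQuery (fstF (nthF 0 z), bitsToNat (nthF 1 z) - 1) := by
  simp [clauseQueryFn, fanoutFn_apply, predCntF_eq, encodeClauseQuery]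

/-- The query word of a genuine record. [folklore] -/
theorem clauseQueryFn_rec (x y : List Bool) (k : ℕ) (s : List Bool) :
    clauseQueryFn (rec x y k s) = encodeClauseQuery (x, k) := by
  rw [clauseQueryFn_eq]
  simp [rec, encodeClauseQuery]

/-- `clauseQueryFn ∈ FP`. [folklore] -/
theorem clauseQueryFn_mem_FP : clauseQueryFn ∈ FP :=
  fanoutFn_mem_FP (comp_mem_FP fstF_mem_FP (nthF_mem_FP 0)) predCntF_mem_FP

/-- The clause code of the current round: `code (cl x (counter - 1))`. [folklore] -/
def clauseFn (cl : List Bool → ℕ → Clause ℕ) : List Bool → List Bool :=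
  fun z => encodingClause.encode (cl (fstF (nthF 0 z)) (bitsToNat (nthF 1 z) - 1))

/-- The clause code of a genuine record. [folklore] -/
theorem clauseFn_rec (cl : List Bool → ℕ → Clause ℕ) (x y : List Bool) (k : ℕ) (s : List Bool) :
    clauseFn cl (rec x y k s) = encodingClause.encode (cl x k) := by
  simp [clauseFn, rec]

/-- **The clause code is polynomial time** whenever the clause function is polynomial time on
query words: the query word of a record is always genuine, so the typed composition
`PolyTimeComputable.comp_holds` applies (no behaviour of the clause machine outside query words
is needed). [cite: AroraBarakCC2009, §1.3] -/
theorem clauseFn_mem_FP (cl : List Bool → ℕ → Clause ℕ)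
    (hcl : PolyTimeComputable encodeClauseQuery encodingClause.encode (Function.uncurry cl)) :
    clauseFn cl ∈ FP := by
  let ψ : List Bool → List Bool × ℕ := fun z => (fstF (nthF 0 z), bitsToNat (nthF 1 z) - 1)
  have hψ : PolyTimeComputable (id : List Bool → List Bool) encodeClauseQuery ψ :=
    clauseQueryFn_mem_FP.of_encode (g := id) (fun _ => rfl) fun z => (clauseQueryFn_eq z)
  have hcomp := PolyTimeComputable.comp_holds hcl hψ
  exact hcomp.of_encode (g := id) (fun _ => rfl) fun _ => rfl

/-- The arity word `1ᵏ` of the current clause. [folklore] -/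
def arityFn (cl : List Bool → ℕ → Clause ℕ) : List Bool → List Bool := nthF 0 ∘ clauseFn cl

/-- The code of literal `j + 1` (`j = 0, 1, 2`) of the current clause. [folklore] -/
def litFn (cl : List Bool → ℕ → Clause ℕ) (j : ℕ) : List Bool → List Bool := nthF (j + 1) ∘ clauseFn cl

/-- The test "the current clause has more than `j` literals". [folklore] -/
noncomputable def geFn (cl : List Bool → ℕ → Clause ℕ) (j : ℕ) : List Bool → List Bool :=
  notFn (isNilFn ∘ dropFn ∘ fanoutFn (fun _ => List.replicate j true) (arityFn cl))

/-- The table bit of literal `j + 1`: `(y ↓ min v |y|) ↾ 1` for the variable `v` of the literal.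
[folklore] -/
noncomputable def bitFn (cl : List Bool → ℕ → Clause ℕ) (j : ℕ) : List Bool → List Bool :=
  bitAtFn ∘ fanoutFn (binToUnaryFn ∘ fanoutFn (sndF ∘ nthF 0) (fstF ∘ litFn cl j)) (sndF ∘ nthF 0)

/-- The test "literal `j + 1` is true under the table". [folklore] -/
noncomputable def litOKFn (cl : List Bool → ℕ → Clause ℕ) (j : ℕ) : List Bool → List Bool :=
  eqPairFn ∘ fanoutFn (eqPairFn ∘ fanoutFn (bitFn cl j) (fun _ => [true])) (sndF ∘ litFn cl j)

/-- The test "the current clause is satisfied by the table" (at most three literals).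
[folklore] -/
noncomputable def okClauseFn (cl : List Bool → ℕ → Clause ℕ) : List Bool → List Bool :=
  orFn (andFn (geFn cl 0) (litOKFn cl 0))
    (orFn (andFn (geFn cl 1) (litOKFn cl 1)) (andFn (geFn cl 2) (litOKFn cl 2)))

/-- The loop body: new state `[state = [1]] ∧ [clause satisfied]`. [folklore] -/
noncomputable def bodyFn (cl : List Bool → ℕ → Clause ℕ) : List Bool → List Bool :=
  andFn (eqPairFn ∘ fanoutFn (sndPow 1) (fun _ => [true])) (okClauseFn cl)

/-! #### One-bit-ness and `FP` -/

/-- `geFn` is one-bit. [folklore] -/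
theorem oneBit_geFn (cl : List Bool → ℕ → Clause ℕ) (j : ℕ) : OneBit (geFn cl j) :=
  oneBit_notFn (oneBit_isNilFn.comp _)

/-- `litOKFn` is one-bit. [folklore] -/
theorem oneBit_litOKFn (cl : List Bool → ℕ → Clause ℕ) (j : ℕ) : OneBit (litOKFn cl j) :=
  oneBit_eqPairFn.comp _

/-- `okClauseFn` is one-bit. [folklore] -/
theorem oneBit_okClauseFn (cl : List Bool → ℕ → Clause ℕ) : OneBit (okClauseFn cl) :=
  oneBit_orFn (oneBit_andFn (oneBit_geFn cl 0) (oneBit_litOKFn cl 0))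
    (oneBit_orFn (oneBit_andFn (oneBit_geFn cl 1) (oneBit_litOKFn cl 1))
      (oneBit_andFn (oneBit_geFn cl 2) (oneBit_litOKFn cl 2)))

/-- `bodyFn` is one-bit. [folklore] -/
theorem oneBit_bodyFn (cl : List Bool → ℕ → Clause ℕ) : OneBit (bodyFn cl) :=
  oneBit_andFn (oneBit_eqPairFn.comp _) (oneBit_okClauseFn cl)

/-- All pieces are in `FP` when the clause code is. [folklore] -/
theorem bodyFn_mem_FP {cl : List Bool → ℕ → Clause ℕ} (hF : clauseFn cl ∈ FP) :
    bodyFn cl ∈ FP := by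
  have hlit : ∀ j, litFn cl j ∈ FP := fun j => comp_mem_FP (nthF_mem_FP _) hF
  have hge : ∀ j, geFn cl j ∈ FP := fun j =>
    notFn_mem_FP (comp_mem_FP isNilFn_mem_FP (comp_mem_FP dropFn_mem_FP
      (fanoutFn_mem_FP (const_mem_FP _) (comp_mem_FP (nthF_mem_FP 0) hF))))
  have hbit : ∀ j, bitFn cl j ∈ FP := fun j =>
    comp_mem_FP bitAtFn_mem_FP (fanoutFn_mem_FP (comp_mem_FP binToUnaryFn_mem_FP
      (fanoutFn_mem_FP (comp_mem_FP sndF_mem_FP (nthF_mem_FP 0))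
        (comp_mem_FP fstF_mem_FP (hlit j)))) (comp_mem_FP sndF_mem_FP (nthF_mem_FP 0)))
  have hok : ∀ j, litOKFn cl j ∈ FP := fun j =>
    comp_mem_FP eqPairFn_mem_FP (fanoutFn_mem_FP
      (comp_mem_FP eqPairFn_mem_FP (fanoutFn_mem_FP (hbit j) (const_mem_FP _)))
      (comp_mem_FP sndF_mem_FP (hlit j)))
  have hcl : okClauseFn cl ∈ FP :=
    orFn_mem_FP (andFn_mem_FP (hge 0) (hok 0))
      (orFn_mem_FP (andFn_mem_FP (hge 1) (hok 1)) (andFn_mem_FP (hge 2) (hok 2)))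
  exact andFn_mem_FP (comp_mem_FP eqPairFn_mem_FP
    (fanoutFn_mem_FP (sndPow_mem_FP 1) (const_mem_FP _))) hcl

/-! #### Values on genuine records -/

/-- The code of a clause, spelled out: `⟨1ᵏ, ⟨code ℓ₁, ⟨code ℓ₂, … ε⟩⟩⟩`. [folklore] -/
theorem encodingClause_encode_eq (C : Clause ℕ) : encodingClause.encode C =
    boolPair (unaryEncodeNat C.length)
      (C.foldr (fun l acc => boolPair (encodingLiteral.encode l) acc) []) := rfl

/-- The code of a literal: `⟨bin v, [b]⟩` (twin of `CNFIsing.encodingLiteral_encode` in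
`Barriers/HubbardSuperconductivity/SignProblemNPHardMachines.lean`, downstream of the toolkit).
[folklore] -/
theorem encodingLiteral_encode_eq (l : Literal ℕ) :
    encodingLiteral.encode l = boolPair (encodeNat l.1) [l.2] := rfl

/-- The satisfaction test of a literal against the table, as computed by the bricks.
[folklore] -/
def litHolds (y : List Bool) (l : Literal ℕ) : Bool :=
  decide (decide ((y.drop (min l.1 y.length)).take 1 = [true]) = l.2)

/-- The brick test agrees with the evaluation of the literal under the table assignment.
[folklore] -/
theorem litHolds_eq_eval (y : List Bool) (l : Literal ℕ) :
    litHolds y l = Literal.eval (tableAssignment y) l := by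
  obtain ⟨v, b⟩ := l
  simp only [litHolds, Literal.eval, tableAssignment]
  by_cases hv : v < y.length
  · rw [Nat.min_eq_left hv.le, List.take_one_drop_eq_of_lt_length hv, List.getD_eq_getElem _ _ hv]
    cases h : y[v] <;> cases b <;> simp [h, hv]
  · rw [Nat.min_eq_right (Nat.le_of_not_lt hv), List.drop_length]
    cases b <;> simp [hv]

/-- The satisfaction test of a clause with at most three literals, as computed by the bricks.
[folklore] -/
def clauseHolds (y : List Bool) (C : Clause ℕ) : Bool :=
  (decide (0 < C.length) && litHolds y (C.getD 0 (0, false))) ||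
    ((decide (1 < C.length) && litHolds y (C.getD 1 (0, false))) ||
      (decide (2 < C.length) && litHolds y (C.getD 2 (0, false))))

/-- For clauses with at most three literals the brick test is the evaluation of the clause
under the table assignment. [folklore] -/
theorem clauseHolds_eq_eval (y : List Bool) {C : Clause ℕ} (hC : C.length ≤ 3) :
    clauseHolds y C = Clause.eval (tableAssignment y) C := by
  rcases C with _ | ⟨l₁, _ | ⟨l₂, _ | ⟨l₃, _ | ⟨l₄, C⟩⟩⟩⟩
  · simp [clauseHolds, Clause.eval]
  · simp [clauseHolds, Clause.eval, litHolds_eq_eval]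
  · simp [clauseHolds, Clause.eval, litHolds_eq_eval]
  · simp [clauseHolds, Clause.eval, litHolds_eq_eval]
  · simp only [List.length_cons] at hC
    omega

/-- The arity word on a genuine record. [folklore] -/
theorem arityFn_rec (cl : List Bool → ℕ → Clause ℕ) (x y : List Bool) (k : ℕ) (s : List Bool) :
    arityFn cl (rec x y k s) = List.replicate (cl x k).length true := by
  simp [arityFn, clauseFn_rec, encodingClause_encode_eq, OracleCompose.unaryEncodeNat_eq_replicate]

/-- `geFn j` on a genuine record: `[j < k]`. [folklore] -/
theorem geFn_rec (cl : List Bool → ℕ → Clause ℕ) (j : ℕ) (x y : List Bool) (k : ℕ) (s : List Bool) :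
    geFn cl j (rec x y k s) = [decide (j < (cl x k).length)] := by
  have h : (isNilFn ∘ dropFn ∘ fanoutFn (fun _ => List.replicate j true) (arityFn cl))
      (rec x y k s) = [decide ((cl x k).length ≤ j)] := by
    simp [fanoutFn_apply, arityFn_rec cl, isNilFn, List.drop_replicate, Nat.sub_eq_zero_iff_le]
  rw [geFn, notFn_apply h]
  by_cases hjk : (cl x k).length ≤ j
  · simp [hjk, Nat.not_lt.2 hjk]
  · simp [hjk, Nat.lt_of_not_le hjk]

/-- The literal code on a genuine record, for an existing literal. [folklore] -/
theorem litFn_rec (cl : List Bool → ℕ → Clause ℕ) {j : ℕ} (x y : List Bool) (k : ℕ) (s : List Bool) (hj : j < (cl x k).length) :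
    litFn cl j (rec x y k s) = encodingLiteral.encode ((cl x k)[j]) := by
  simp only [litFn, Function.comp_apply, clauseFn_rec, encodingClause_encode_eq,
    nthF_succ_boolPair]
  -- walk down the fold
  generalize cl x k = C at hj ⊢
  induction C generalizing j with
  | nil => simp at hj
  | cons l C ih =>
    cases j with
    | zero => simp
    | succ j =>
      simp only [List.foldr_cons, nthF_succ_boolPair, List.getElem_cons_succ]
      exact ih (by simpa using hj)

/-- `litOKFn j` on a genuine record, for an existing literal. [folklore] -/
theorem litOKFn_rec (cl : List Bool → ℕ → Clause ℕ) {j : ℕ} (x y : List Bool) (k : ℕ) (s : List Bool) (hj : j < (cl x k).length) :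
    litOKFn cl j (rec x y k s) = [litHolds y ((cl x k)[j])] := by
  simp only [litOKFn, bitFn, Function.comp_apply, fanoutFn_apply]
  rw [litFn_rec cl x y k s hj]
  simp only [encodingLiteral_encode_eq, fstF_boolPair, sndF_boolPair, eqPairFn_boolPair]
  have hy : sndF (nthF 0 (rec x y k s)) = y := by simp [rec]
  rw [hy, binToUnaryFn_boolPair, bitsToNat_encodeNat, bitAtFn_boolPair]
  simp [ones, litHolds]

/-- `okClauseFn` on a genuine record: the clause test (at most three literals). [folklore] -/
theorem okClauseFn_rec (cl : List Bool → ℕ → Clause ℕ) (x y : List Bool) (k : ℕ) (s : List Bool) :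
    okClauseFn cl (rec x y k s) = [clauseHolds y (cl x k)] := by
  have hand : ∀ j, andFn (geFn cl j) (litOKFn cl j) (rec x y k s) =
      [decide (j < (cl x k).length) && litHolds y ((cl x k).getD j (0, false))] := by
    intro j
    by_cases hj : j < (cl x k).length
    · rw [andFn_apply (geFn_rec cl j x y k s) (litOKFn_rec cl x y k s hj), List.getD_eq_getElem _ _ hj]
    · obtain ⟨b, hb⟩ := oneBit_litOKFn cl j (rec x y k s)
      rw [andFn_apply (geFn_rec cl j x y k s) hb]
      simp [hj]
  rw [okClauseFn, orFn_apply (hand 0) (orFn_apply (hand 1) (hand 2)), clauseHolds]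

/-- **The loop body on a genuine record**: `[s = [1] ∧ clause k satisfied]`. [folklore] -/
theorem bodyFn_rec (cl : List Bool → ℕ → Clause ℕ) (x y : List Bool) (k : ℕ) (s : List Bool) :
    bodyFn cl (rec x y k s) = [decide (s = [true]) && clauseHolds y (cl x k)] := by
  have h1 : (eqPairFn ∘ fanoutFn (sndPow 1) (fun _ => [true])) (rec x y k s) = [decide (s = [true])] := by
    simp [fanoutFn_apply, eqPairFn_boolPair, rec]
  rw [bodyFn, andFn_apply h1 (okClauseFn_rec cl x y k s)]

/-- Boolean bookkeeping of one round of the loop model. [folklore] -/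
theorem and_and_decide_eq (b ch : Bool) (P Q : Prop) [Decidable P] [Decidable Q]
    (hQ : Q ↔ (ch = true ∧ P)) : ((b && ch) && decide P) = (b && decide Q) := by
  cases b <;> cases ch <;> simp [hQ]

/-- **The loop model**: from state `[b]`, after the rounds `k, k-1, …, 1` the state is
`[b ∧ all clauses below k are satisfied]`. [folklore] -/
theorem loopModel_bodyFn (cl : List Bool → ℕ → Clause ℕ) (x y : List Bool) : ∀ (k : ℕ) (b : Bool),
    loopModel (bodyFn cl) (boolPair x y) k [b] =
      [b && decide (∀ i < k, clauseHolds y (cl x i) = true)]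
  | 0, b => by simp [loopModel]
  | k + 1, b => by
    rw [loopModel, show boolPair (boolPair x y) (boolPair (encodeNat (k + 1)) [b]) = rec x y k [b]
      from rfl, bodyFn_rec, loopModel_bodyFn cl x y k]
    have hiff : (∀ i < k + 1, clauseHolds y (cl x i) = true) ↔
        (clauseHolds y (cl x k) = true ∧ ∀ i < k, clauseHolds y (cl x i) = true) :=
      ⟨fun h => ⟨h k (Nat.lt_succ_self k), fun i hi => h i (Nat.lt_succ_of_lt hi)⟩,
       fun h i hi => by
        rcases Nat.lt_succ_iff_lt_or_eq.1 hi with hi | rfl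
        · exact h.2 i hi
        · exact h.1⟩
    have hdec : decide (([b] : List Bool) = [true]) = b := by cases b <;> decide
    rw [hdec, and_and_decide_eq b (clauseHolds y (cl x k)) _ _ hiff]

/-! ### The checker -/

/-- The initial loop record `⟨w, ⟨bin 2^{width}, [1]⟩⟩` on the input `w = ⟨x, y⟩`. [folklore] -/
noncomputable def initFn (c : ℕ) : List Bool → List Bool :=
  fanoutFn id (fanoutFn (powTwoWidthFn c ∘ fstF) (fun _ => [true]))

/-- The loop run for `|w|` rounds, followed by the state test. [folklore] -/
noncomputable def loopOutFn (c : ℕ) (cl : List Bool → ℕ → Clause ℕ) : List Bool → List Bool :=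
  (eqPairFn ∘ fanoutFn (sndPow 1) (fun _ => [true])) ∘
    (fun z => (loopStep (bodyFn cl))^[(X : Polynomial ℕ).eval (fstF z).length] z) ∘ initFn c

/-- The length test `|y| = 2 ^ tableExp c |x|`. [folklore] -/
noncomputable def lenTestFn (c : ℕ) : List Bool → List Bool :=
  eqPairFn ∘ fanoutFn (lenBinF ∘ sndF) (powTwoPolyFn (tableExpPoly c) ∘ fstF)

/-- **The clause-table checker** of the succinct reduction `cl` with constant `c`. [folklore] -/
noncomputable def checkFn (c : ℕ) (cl : List Bool → ℕ → Clause ℕ) : List Bool → List Bool :=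
  andFn (lenTestFn c) (loopOutFn c cl)

/-- **The checker is polynomial time** (in its input length `2|x| + 2 + |y|`) whenever the
clause function is polynomial time on query words. [cite: AroraBarakCC2009, §1.3] -/
theorem checkFn_mem_FP (c : ℕ) (cl : List Bool → ℕ → Clause ℕ)
    (hcl : PolyTimeComputable encodeClauseQuery encodingClause.encode (Function.uncurry cl)) :
    checkFn c cl ∈ FP := by
  have hbody := bodyFn_mem_FP (clauseFn_mem_FP cl hcl)
  have hloop : (fun z => (loopStep (bodyFn cl))^[(X : Polynomial ℕ).eval (fstF z).length] z) ∈ FP :=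
    loopFn_mem_FP hbody (c := 1) (fun z => by
      rw [(oneBit_bodyFn cl).length_eq z]; omega) X
  have hinit : initFn c ∈ FP :=
    fanoutFn_mem_FP OracleCompose.id_mem_FP
      (fanoutFn_mem_FP (comp_mem_FP (powTwoWidthFn_mem_FP c) fstF_mem_FP) (const_mem_FP _))
  have hout : loopOutFn c cl ∈ FP :=
    comp_mem_FP (comp_mem_FP eqPairFn_mem_FP (fanoutFn_mem_FP (sndPow_mem_FP 1) (const_mem_FP _)))
      (comp_mem_FP hloop hinit)
  have hlen : lenTestFn c ∈ FP :=
    comp_mem_FP eqPairFn_mem_FP (fanoutFn_mem_FP (comp_mem_FP lenBinF_mem_FP sndF_mem_FP)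
      (comp_mem_FP (powTwoPolyFn_mem_FP _) fstF_mem_FP))
  exact andFn_mem_FP hlen hout

/-- The checker is one-bit on every input. [folklore] -/
theorem oneBit_checkFn (c : ℕ) (cl : List Bool → ℕ → Clause ℕ) : OneBit (checkFn c cl) :=
  oneBit_andFn (oneBit_eqPairFn.comp _) ((oneBit_eqPairFn.comp _).comp _)

/-- **Value of the checker**: on `⟨x, y⟩` it accepts iff `|y| = 2 ^ tableExp c |x|` and every
clause `cl x i`, `i < 2 ^ succinctWidth c |x|`, passes the brick test `clauseHolds y`
(for clauses with at most three literals this is satisfaction under `tableAssignment y`,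
`clauseHolds_eq_eval`). [folklore] -/
theorem checkFn_boolPair (c : ℕ) (cl : List Bool → ℕ → Clause ℕ) (x y : List Bool) :
    checkFn c cl (boolPair x y) = [decide (y.length = 2 ^ tableExp c x.length ∧
      ∀ i < 2 ^ succinctWidth c x.length, clauseHolds y (cl x i) = true)] := by
  have hlen : lenTestFn c (boolPair x y) = [decide (y.length = 2 ^ tableExp c x.length)] := by
    simp only [lenTestFn, Function.comp_apply, fanoutFn_apply, eqPairFn_boolPair, sndF_boolPair,
      fstF_boolPair, lenBinF_apply, powTwoPolyFn_apply, eval_tableExpPoly,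
      encodeNat_inj]
  by_cases hy : y.length = 2 ^ tableExp c x.length
  · -- enough rounds: `2 ^ width ≤ |⟨x, y⟩|`
    have hK : 2 ^ succinctWidth c x.length ≤ (boolPair x y).length := by
      rw [length_boolPair, hy]
      exact (Nat.pow_le_pow_right Nat.two_pos (succinctWidth_le_tableExp c x.length)).trans
        (by omega)
    have hloop : loopOutFn c cl (boolPair x y) =
        [decide (∀ i < 2 ^ succinctWidth c x.length, clauseHolds y (cl x i) = true)] := by
      simp only [loopOutFn, Function.comp_apply, initFn, fanoutFn_apply, id, fstF_boolPair,
        powTwoWidthFn_apply, eval_X]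
      rw [iterate_loopStep (bodyFn cl) (boolPair x y) _ _ _ hK, loopModel_bodyFn cl]
      simp [eqPairFn_boolPair]
    rw [checkFn, andFn_apply hlen hloop]
    simp [hy]
  · have hob : OneBit (loopOutFn c cl) := (oneBit_eqPairFn.comp _).comp _
    obtain ⟨b, hb⟩ := hob (boolPair x y)
    rw [checkFn, andFn_apply hlen hb]
    simp [hy]

end ClauseCheck

end Literature.Computability.Complexity
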